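import Summits.ResolutionOfSingularities.ResolutionOfSingularities.Theorems.HomologicalConductorNoZenoBirthDefs
import Summits.ResolutionOfSingularities.ResolutionOfSingularities.Theorems.SyzygyFlatteningHigherRankTerminationNrmLocAt
import HarnessLib

/-!
# Crux `NoZeno` / `NoZenoR` (stmt-ResolutionOfSingularities-16483 / -19943), line `sandwich-cluster`:
# the CAPTURE step (`captureOfPrincipal`) and units detected by the order pseudo-valuation ring
# (`inv_mem_of_inv_mem_ordSet`)

Route `ResolutionOfSingularities/HomologicalConductor`.  OURS (cell res-hironaka); nothing here is a
statement of the manuscript under review.  The planner's second-layer split of the surface core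
`stub_sandwichedTermination` of the crux (line `sandwich-cluster`, CRUX-PLAN W4.4 v2 §2) types two
«provable-now support targets» `Sig.captureOfPrincipal` and `Sig.ordSet_dominates`; this file proves
both, stated in TREE vocabulary only (`ca`, `loc`, `chart`, `nrm` of
`Theorems/HomologicalConductorNoZenoBirthDefs.lean`; the line's `Dominates V T :=
∀ t ∈ T, t ∈ V ∧ (t⁻¹ ∈ V → t⁻¹ ∈ T)` and the order pseudo-valuation set `ordSet S` are UNFOLDED
in the statements, so that the line file derives its `Sig.*` forms by `fun … => …` alone).

* `captureOfPrincipal` — the ⊆ half («no new base point», CAPTURE) of the cluster calculus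
  `stub_basePtsStrictAnti`: if `T ≤ S`, `S` is integrally closed in `K`, the cohomology annihilator
  `ca T` generates a PRINCIPAL ideal `(g)` of `S`, every element of `S` whose inverse lies in `V` is
  inverted in `S`, and the next stage `T⁺ := loc O (nrm (chart O T))` lies in `V`, where `V ⊆ K` is
  closed under `+` and `*` (any `SubsemiringClass`, e.g. a valuation ring), then `T⁺ ≤ S`.
  Proof: for a chart denominator `x ∈ ca T` (`x ≠ 0`, of minimal value) write `x = u·g` in `S`;
  `g/x = Σ rᵢ·(cᵢ/x)` lies in `V` (`rᵢ ∈ S ⊆ V`, `cᵢ/x ∈ chart O T ⊆ T⁺ ⊆ V`) and is the inverse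
  of `u ∈ S`, hence lies in `S`; so every `c/x = w·(g/x)` (`c = w·g`) lies in `S`: `chart O T ≤ S`;
  then `nrm (chart O T) ≤ S` (`S` integrally closed in `K`) and `loc O (nrm _) ≤ S` (a denominator
  `s` with `s⁻¹ ∈ O` has `s⁻¹ ∈ T⁺ ⊆ V`, hence `s⁻¹ ∈ S`).  No property of `O` is used.
* `captureOfPrincipal_valuationSubring` — the same with `V : ValuationSubring K` and both
  domination clauses in full: VERBATIM the body of the line's `Sig.captureOfPrincipal`.
* `inv_mem_of_inv_mem_ordSet` — VERBATIM the body of `Sig.ordSet_dominates`: for a LOCAL `S`, an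
  `s ∈ S` with `s⁻¹ = a/b`, `a, b ∈ Jⁿ`, `b ∉ Jⁿ⁺¹` (`J` the Jacobson radical `= 𝔪_S`) is a unit
  of `S` (else `s ∈ 𝔪_S` and `b = s·a ∈ Jⁿ⁺¹`).

References: J. Lipman, Rational singularities…, Publ. IHÉS 36 (1969) §18 [`Lipman1969`];
M. Spivakovsky, Sandwiched singularities and desingularization of surfaces by normalized Nash
transformations, Ann. of Math. 131 (1990) §II [`Spivakovsky1990`] (the dictionary «base points of a
complete ideal ↔ exceptional curves»; the two lemmas themselves are folklore ring theory).
-/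

noncomputable section

-- single-problem summit: the doubled namespace component `ResolutionOfSingularities` is forced
set_option linter.dupNamespace false

namespace Summit.ResolutionOfSingularities.ResolutionOfSingularities.Theorems.NoZeno.SandwichCluster

open Summit.ResolutionOfSingularities.ResolutionOfSingularities.Theses.HomologicalConductor
open Summit.ResolutionOfSingularities.ResolutionOfSingularities.Theorems.NoZeno.Birth

variable {k K : Type} [Field k] [Field K] [Algebra k K]

/-! ## Small membership facts for the next stage `loc O (nrm (chart O T))` -/

/-- A chart ratio `c * x⁻¹` (`c, x ∈ ca T`, `x ≠ 0` of minimal value) lies in `chart O T`.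
[folklore] -/
theorem mul_inv_mem_chart (O : ValuationSubring K) (T : Subalgebra k K) {c x : K} (hc : c ∈ ca T)
    (hx : x ∈ ca T) (hx0 : x ≠ 0) (hmin : ∀ c' ∈ ca T, c' * x⁻¹ ∈ O) :
    c * x⁻¹ ∈ chart O T :=
  Algebra.subset_adjoin (Or.inr ⟨c, hc, x, hx, hx0, hmin, rfl⟩)

/-- `chart O T ≤ loc O (nrm (chart O T))`. [folklore] -/
theorem chart_le_loc_nrm_chart (O : ValuationSubring K) (T : Subalgebra k K) :
    chart O T ≤ loc O (nrm (chart O T)) :=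
  (SyzygyFlattening.self_le_nrm (chart O T)).trans (SyzygyFlattening.self_le_locAt O _)

/-- The inverse of a denominator of `loc O B` lies in `loc O B`: `s ∈ B`, `s⁻¹ ∈ O` give
`s⁻¹ = 1 * s⁻¹ ∈ loc O B`. [folklore] -/
theorem inv_mem_loc (O : ValuationSubring K) (B : Subalgebra k K) {s : K} (hs : s ∈ B)
    (hsO : s⁻¹ ∈ O) : s⁻¹ ∈ loc O B := by
  have h := SyzygyFlattening.mul_inv_mem_locAt O B B.one_mem hs hsO
  rwa [one_mul] at h

/-! ## The capture step -/

/-- **CAPTURE (the ⊆ half of the cluster calculus `stub_basePtsStrictAnti`, line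
`sandwich-cluster`).**  Let `T ≤ S` be `k`-subalgebras of `K` with `S` integrally closed in `K`,
suppose the ideal of `S` generated by the cohomology annihilator `ca T` is principal, let `V ⊆ K` be
closed under addition and multiplication (e.g. a valuation ring of `K`) such that every element of
`S` lies in `V` and is inverted in `S` as soon as it is inverted in `V`, and suppose the next stage
`loc O (nrm (chart O T))` of the canonical `ca`-tower lies in `V`.  Then
`loc O (nrm (chart O T)) ≤ S`.  [cite: Lipman1969, §18; Spivakovsky1990, §II] -/
theorem captureOfPrincipal {σ : Type*} [SetLike σ K] [SubsemiringClass σ K]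
    (O : ValuationSubring K) (V : σ) (T S : Subalgebra k K) (hTS : T ≤ S)
    (hS : ∀ y : K, IsIntegral ↥S y → y ∈ S)
    (hca : (Ideal.span {s : ↥S | (s : K) ∈ ca T}).IsPrincipal)
    (hVS : ∀ t : K, t ∈ S → t ∈ (V : Set K) ∧ (t⁻¹ ∈ (V : Set K) → t⁻¹ ∈ S))
    (hVT : ∀ t : K, t ∈ loc O (nrm (chart O T)) → t ∈ (V : Set K)) :
    loc O (nrm (chart O T)) ≤ S := by
  -- Step 1: the chart lies in `S`
  have hchart : chart O T ≤ S := by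
    refine Algebra.adjoin_le ?_
    rintro y (hy | ⟨c, hc, x, hx, hx0, hmin, rfl⟩)
    · exact hTS hy
    · -- the principal generator `g` of `ca T · S`
      set I : Ideal ↥S := Ideal.span {s : ↥S | (s : K) ∈ ca T} with hI
      obtain ⟨g, hg⟩ := (Submodule.IsPrincipal.principal I : ∃ g, I = Ideal.span {g})
      have hxS : x ∈ S := hTS (ca_subset T hx)
      have hcS : c ∈ S := hTS (ca_subset T hc)
      have hxI : (⟨x, hxS⟩ : ↥S) ∈ I := Ideal.subset_span hx
      have hcI : (⟨c, hcS⟩ : ↥S) ∈ I := Ideal.subset_span hc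
      rw [hg, Ideal.mem_span_singleton'] at hxI hcI
      obtain ⟨u, hu⟩ := hxI
      obtain ⟨w, hw⟩ := hcI
      have huK : (u : K) * (g : K) = x := by
        have := congrArg Subtype.val hu
        simpa using this
      have hwK : (w : K) * (g : K) = c := by
        have := congrArg Subtype.val hw
        simpa using this
      -- `g * x⁻¹ ∈ V`: the elements `s ∈ S` with `s * x⁻¹ ∈ V` form an ideal containing `ca T`
      let P : Ideal ↥S :=
        { carrier := {s : ↥S | (s : K) * x⁻¹ ∈ (V : Set K)}
          zero_mem' := by
            change ((0 : ↥S) : K) * x⁻¹ ∈ (V : Set K)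
            rw [ZeroMemClass.coe_zero, zero_mul]
            exact zero_mem V
          add_mem' := by
            intro a b ha hb
            change ((a + b : ↥S) : K) * x⁻¹ ∈ (V : Set K)
            rw [Subalgebra.coe_add, add_mul]
            exact add_mem ha hb
          smul_mem' := by
            intro r a ha
            change ((r • a : ↥S) : K) * x⁻¹ ∈ (V : Set K)
            rw [smul_eq_mul, Subalgebra.coe_mul, mul_assoc]
            exact mul_mem (hVS r r.2).1 ha }
      have hIP : I ≤ P := by
        rw [hI, Ideal.span_le]
        intro s hs
        exact hVT _ (chart_le_loc_nrm_chart O T (mul_inv_mem_chart O T hs hx hx0 hmin))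
      have hgP : g ∈ P := hIP (by rw [hg]; exact Ideal.mem_span_singleton_self g)
      have hgx : (g : K) * x⁻¹ ∈ (V : Set K) := hgP
      -- `u = x / g ∈ S` has inverse `g / x ∈ V`, hence `g / x ∈ S`
      have huinv : ((u : K))⁻¹ = (g : K) * x⁻¹ :=
        inv_eq_of_mul_eq_one_right (by rw [← mul_assoc, huK, mul_inv_cancel₀ hx0])
      have hgxS : (g : K) * x⁻¹ ∈ S := by
        have h := (hVS (u : K) u.2).2 (by rw [huinv]; exact hgx)
        rwa [huinv] at h
      -- `c / x = w * (g / x)`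
      have : c * x⁻¹ = (w : K) * ((g : K) * x⁻¹) := by rw [← hwK, mul_assoc]
      rw [this]
      exact S.mul_mem w.2 hgxS
  -- Step 2: the normalisation of the chart lies in `S` (`S` integrally closed in `K`)
  have hnrm : nrm (chart O T) ≤ S :=
    Algebra.adjoin_le fun y hy => hS y (SyzygyFlattening.isIntegral_of_le hchart hy)
  -- Step 3: the localisation lies in `S` (denominators are inverted in `V`, hence in `S`)
  refine Algebra.adjoin_le ?_
  rintro y ⟨a, ha, s, hs, hsO, rfl⟩
  have hsinv : s⁻¹ ∈ S := (hVS s (hnrm hs)).2 (hVT _ (inv_mem_loc O (nrm (chart O T)) hs hsO))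
  exact S.mul_mem (hnrm ha) hsinv

/-- **CAPTURE, valuation-ring form** — VERBATIM the body of the line's support target
`Sig.captureOfPrincipal` (`L/res-L0-w44-plan-1/SandwichCluster.lean`, sha16 1b03eebffb9f78d9),
with `Dominates V X := ∀ t ∈ X, t ∈ V ∧ (t⁻¹ ∈ V → t⁻¹ ∈ X)` unfolded: if `T ≤ S`, `S` is integrally
closed in `K`, `ca T · S` is principal, and a valuation ring `V` dominates both `S` and the next stage
`loc O (nrm (chart O T))`, then the next stage lies in `S`. [cite: Lipman1969, §18; Spivakovsky1990, §II] -/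
theorem captureOfPrincipal_valuationSubring (O V : ValuationSubring K) (T S : Subalgebra k K)
    (hTS : T ≤ S) (hS : ∀ y : K, IsIntegral ↥S y → y ∈ S)
    (hca : (Ideal.span {s : ↥S | (s : K) ∈ ca T}).IsPrincipal)
    (hVS : ∀ t : K, t ∈ S → t ∈ (V : Set K) ∧ (t⁻¹ ∈ (V : Set K) → t⁻¹ ∈ S))
    (hVT : ∀ t : K, t ∈ loc O (nrm (chart O T)) →
      t ∈ (V : Set K) ∧ (t⁻¹ ∈ (V : Set K) → t⁻¹ ∈ loc O (nrm (chart O T)))) :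
    loc O (nrm (chart O T)) ≤ S :=
  captureOfPrincipal O V T S hTS hS hca hVS fun t ht => (hVT t ht).1

/-! ## Units detected by the order pseudo-valuation ring -/

/-- **`ordSet S` dominates `S`** — VERBATIM the body of the line's support target
`Sig.ordSet_dominates`: for a LOCAL `k`-subalgebra `S` of `K` with Jacobson radical `J` (`= 𝔪_S`),
an element `s ∈ S` whose inverse is a quotient `a * b⁻¹` with `a, b ∈ Jⁿ`, `b ∉ Jⁿ⁺¹` is a unit of
`S`: otherwise `s ∈ 𝔪_S` and `b = s * a ∈ Jⁿ⁺¹`.  (For regular `S` these quotients form the valuation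
ring of the `𝔪_S`-adic order valuation, which therefore dominates `S`.) [folklore] -/
theorem inv_mem_of_inv_mem_ordSet (S : Subalgebra k K) (hS : IsLocalRing ↥S) (s : K) (hs : s ∈ S)
    (h : ∃ n : ℕ, ∃ a b : ↥S, a ∈ ((⊥ : Ideal ↥S).jacobson) ^ n ∧
      b ∈ ((⊥ : Ideal ↥S).jacobson) ^ n ∧ b ∉ ((⊥ : Ideal ↥S).jacobson) ^ (n + 1) ∧
      s⁻¹ = (a : K) * ((b : K))⁻¹) :
    s⁻¹ ∈ S := by
  haveI := hS
  by_cases hs0 : s = 0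
  · rw [hs0, inv_zero]; exact S.zero_mem
  by_cases hunit : IsUnit (⟨s, hs⟩ : ↥S)
  · obtain ⟨t, ht⟩ := hunit.exists_left_inv
    have htK : (t : K) * s = 1 := by
      have := congrArg Subtype.val ht
      simpa using this
    rw [inv_eq_of_mul_eq_one_left htK]
    exact t.2
  · exfalso
    obtain ⟨n, a, b, ha, hb, hb', heq⟩ := h
    have hJ : (⊥ : Ideal ↥S).jacobson = IsLocalRing.maximalIdeal ↥S :=
      IsLocalRing.jacobson_eq_maximalIdeal ⊥ bot_ne_top
    have hsJ : (⟨s, hs⟩ : ↥S) ∈ (⊥ : Ideal ↥S).jacobson := by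
      rw [hJ]; exact hunit
    have hb0 : (b : K) ≠ 0 := by
      intro h0
      apply hb'
      have : b = 0 := Subtype.ext h0
      rw [this]; exact zero_mem _
    -- `b = s * a`
    have hba : b = ⟨s, hs⟩ * a := by
      apply Subtype.ext
      change (b : K) = s * (a : K)
      have h1 : s⁻¹ * (b : K) = (a : K) := by
        rw [heq, mul_assoc, inv_mul_cancel₀ hb0, mul_one]
      rw [← h1, ← mul_assoc, mul_inv_cancel₀ hs0, one_mul]
    apply hb'
    rw [hba, pow_succ']
    exact Ideal.mul_mem_mul (by simpa using hsJ) ha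

end Summit.ResolutionOfSingularities.ResolutionOfSingularities.Theorems.NoZeno.SandwichCluster

end
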